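import Summits.SmoothPoincare4.SmoothPoincare4.Theses.ConvexBisection
import Summits.SmoothPoincare4.SmoothPoincare4.Theorems.ContractibleTwistedDoubleStandard.Negative.DoubleBisection
import Mathlib.Algebra.Quandle
import HarnessLib

/-!
# Sketch — crux-ideate round 2, ideator 5, crux stmt-SmoothPoincare4-10507 (`AcyclicBisectionRigidity`)

First lemmas of the two idea cards filed by this seat (no skeletons at this stage):

* card `achiral-relator-reduction` — §1 (algebraic core: monotone achiral Hurwitz reduction,
  machine-checked on the smallest Hurwitz-inequivalent planar pair of the sibling census),
  §2 (the obstruction group is central: enveloping group of the conjugation quandle),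
  §3 (the transfer target in crux vocabulary and its kernel-checked composition with crux 4).
* card `exchange-recognition` — §4 (the transfer target: the bisection is an `IsBoundaryGluing`
  of an exchange pair; stated over `IsBoundaryGluing`, composition with §3 shape).

Everything here elaborates; §1–§3 are `sorry`-free.
-/

set_option linter.dupNamespace false
set_option autoImplicit false

open scoped Manifold ContDiff Topology ContinuousMap
open Set Function Literature.Geometry.Symplectic Literature.Topology.FourManifolds

namespace Summit.SmoothPoincare4.SmoothPoincare4.Cruxes.AcyclicBisectionRigidity.Ideas

/-! ## §1 Monotone achiral Hurwitz reduction (card `achiral-relator-reduction`)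

A homotopy 4-sphere `M` bisected into two Stein halves over a common open book `(S, φ)` is
`M = Z(F · F̄′) ∪ k(S¹ × D³)` where `F = (t_{v₁}, …, t_{v_ℓ})`, `F′ = (t_{v′₁}, …, t_{v′_ℓ})` are the
positive factorisations of `φ` presenting the halves and `F · F̄′ = t_{v₁}⋯t_{v_ℓ} t_{v′_ℓ}⁻¹⋯t_{v′₁}⁻¹`
is an ACHIRAL word equal to `1` in `Mod(S, ∂S)`.  The lever: reduce this word to the empty word by
(i) achiral Hurwitz moves `(a, b) ↦ (b, b⁻¹ab)` / `(a, b) ↦ (aba⁻¹, a)` (fibre-preserving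
diffeomorphisms of `Z`), (ii) cyclic rotation / global conjugation (re-choice of base arcs), and
(iii) deletion of an adjacent mutually inverse pair `t_a t_a⁻¹` (= inverse of a circle surgery on
`M` along the vanishing cycle `a`).  We model the word as a `List G` for an arbitrary group `G`
(in the application `G = Mod(S,∂S)` and every entry is a signed Dehn twist). -/

section Reduction

variable {G : Type*} [Group G]

/-- **Monotone achiral reducibility** of a cyclic word (list of group elements): the word reaches
the empty word by achiral Hurwitz moves, rotation, global conjugation and deletion of adjacent
inverse pairs — never an insertion. -/
inductive MonotoneReducible : List G → Prop
  | nil : MonotoneReducible []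
  | cancel (pre suf : List G) (a : G) {l : List G} (e : l = pre ++ a :: a⁻¹ :: suf)
      (h : MonotoneReducible (pre ++ suf)) : MonotoneReducible l
  | hurwitz (pre suf : List G) (a b : G) {l : List G} (e : l = pre ++ a :: b :: suf)
      (h : MonotoneReducible (pre ++ b :: (b⁻¹ * a * b) :: suf)) : MonotoneReducible l
  | hurwitzInv (pre suf : List G) (a b : G) {l : List G} (e : l = pre ++ a :: b :: suf)
      (h : MonotoneReducible (pre ++ (a * b * a⁻¹) :: a :: suf)) : MonotoneReducible l
  | rotate {l : List G} (h : MonotoneReducible (l.rotate 1)) : MonotoneReducible l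
  | conj (c : G) {l : List G} (h : MonotoneReducible (l.map fun g => c * g * c⁻¹)) :
      MonotoneReducible l

/-- **The smallest Hurwitz-INEQUIVALENT planar pair reduces** (Cruxes/PlanarBisectionRigidity/
Disproof.lean §7, `twin_identity`): in `F₂ = ⟨x, y⟩ ⊂ PB₃ ⊂ Mod(D₃, ∂)` the two contractible
`k = 4` factorisations `(x, c y c⁻¹)` and `(y⁻¹xy, x⁻¹yx)` of `w = y⁻¹xyx⁻¹yx`, `c = x⁻¹y⁻¹x`,
are not Hurwitz equivalent, yet the achiral word `(x, cyc⁻¹, (x⁻¹yx)⁻¹, (y⁻¹xy)⁻¹)` of the glued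
homotopy sphere `Σ(F, F′)` reduces in three Hurwitz moves and two cancellations — so `Σ(F,F′)` is a
circle-surgery presentation sphere `∂(D₃ × B³ ∪ h⁵(r₁₂) ∪ h⁵(r₂₃) ∪ h⁵(d))`, AC-trivially `S⁴`.
The identity holds in EVERY group, hence in `Mod(D₃, ∂)`. -/
theorem k4_twin_reducible (x y : G) :
    MonotoneReducible
      [x, (x⁻¹ * y⁻¹ * x) * y * (x⁻¹ * y⁻¹ * x)⁻¹, (x⁻¹ * y * x)⁻¹, (y⁻¹ * x * y)⁻¹] := by
  have e0 : (x⁻¹ * y * x)⁻¹ = x⁻¹ * y⁻¹ * x := by group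
  have e0' : (y⁻¹ * x * y)⁻¹ = y⁻¹ * x⁻¹ * y := by group
  rw [e0, e0']
  -- σ₂ : (cyc⁻¹, c) ↦ (c, y)
  refine MonotoneReducible.hurwitz [x] [y⁻¹ * x⁻¹ * y]
    ((x⁻¹ * y⁻¹ * x) * y * (x⁻¹ * y⁻¹ * x)⁻¹) (x⁻¹ * y⁻¹ * x) rfl ?_
  have e1 : (x⁻¹ * y⁻¹ * x)⁻¹ * ((x⁻¹ * y⁻¹ * x) * y * (x⁻¹ * y⁻¹ * x)⁻¹) * (x⁻¹ * y⁻¹ * x) = y := by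
    group
  rw [e1]
  -- σ₃⁻¹ : (y, y⁻¹x⁻¹y) ↦ (x⁻¹, y)
  refine MonotoneReducible.hurwitzInv [x, x⁻¹ * y⁻¹ * x] [] y (y⁻¹ * x⁻¹ * y) rfl ?_
  have e2 : y * (y⁻¹ * x⁻¹ * y) * y⁻¹ = x⁻¹ := by group
  rw [e2]
  -- σ₂ : (c, x⁻¹) ↦ (x⁻¹, xcx⁻¹ = y⁻¹)
  refine MonotoneReducible.hurwitz [x] [y] (x⁻¹ * y⁻¹ * x) x⁻¹ rfl ?_
  have e3 : x⁻¹⁻¹ * (x⁻¹ * y⁻¹ * x) * x⁻¹ = y⁻¹ := by group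
  rw [e3]
  -- cancel (x, x⁻¹), then (y⁻¹, y)
  refine MonotoneReducible.cancel [] [y⁻¹, y] x rfl ?_
  refine MonotoneReducible.cancel [] [] y⁻¹ (by simp) ?_
  exact MonotoneReducible.nil

end Reduction

/-! ## §2 The obstruction group is central (card `achiral-relator-reduction`, obstruction side)

The free group on Dehn-twist symbols modulo the Hurwitz relations `t_a t_b t_a⁻¹ = t_{t_a(b)}` is
the enveloping group `As(Q)` of the Dehn quandle; for any group `G` the kernel of
`As(Conj G) → G` is CENTRAL (conjugation by `n ∈ ker` acts on generators through the image of
`n` in `G`).  Hence the class of the relator `F F̄′` in that kernel is an invariant of the pair,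
computed from the type-count vector (abelianisation) and, on its `H₂(Mod)`-part, from the Meyer
signature and boundary Euler numbers — which vanish for homotopy-sphere bisections. -/

section Quandle

/-- The canonical map `As(Conj G) → G` from the enveloping group of the conjugation quandle. -/
noncomputable def envelToGroup (G : Type*) [Group G] : Rack.EnvelGroup (Quandle.Conj G) →* G :=
  Rack.toEnvelGroup.map (ShelfHom.id (Quandle.Conj G))

/-- **Centrality of the Hurwitz obstruction group** (statement): the kernel of
`As(Conj G) → G` lies in the centre of the enveloping group. -/
def EnvelKernelCentral (G : Type*) [Group G] : Prop :=
  (envelToGroup G).ker ≤ Subgroup.center (Rack.EnvelGroup (Quandle.Conj G))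

end Quandle

/-! ## §3 Transfer target in crux vocabulary and its composition (card `achiral-relator-reduction`)

Monotone reduction of `F F̄′` with cancelled cycles `b₁, …, b_ℓ` exhibits
`M ≅ ∂(S × B³ ∪ ⋃ h⁵(bⱼ × qⱼ))`, a contractible 5-dimensional 2-handlebody `H⁵(𝒫)`; by Gompf's
Legendrian realisation (Disproof §4b) `H⁵(𝒫) = W_𝒫 × I` for a compact contractible STEIN domain
`W_𝒫`, i.e. `M` is a DOUBLE `D(W_𝒫)`.  So the lever lands the non-twin and cork-twist sectors in
the double sector, which crux 4 (`ContractibleTwistedDoubleStandard`, item 3546) — indeed its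
`ψ = id` slice — closes (`double_standard_of_crux`, tree). -/

section Transfer

open Summit.SmoothPoincare4.SmoothPoincare4.Theses
open Summit.SmoothPoincare4.SmoothPoincare4.Theorems.ContractibleTwistedDoubleStandard.Negative

local notation "𝕊⁴" => (Metric.sphere (0 : EuclideanSpace ℝ (Fin 5)) 1)

/-- **DoubleReduction** (transfer target `C⁺` of card `achiral-relator-reduction`): every
homotopy 4-sphere carrying an acyclic common-contact Stein bisection is a double `D(W)` of SOME
compact contractible Stein domain `W` (not of either half!). Reached on paper by: common open book
normal form (Akbulut–Ozbagci + Giroux) ⇒ `M = Z(F F̄′) ∪ k(S¹×D³)`; monotone achiral reduction of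
`F F̄′` (the lever) ⇒ `M = ∂H⁵(𝒫)`; Gompf realisation ⇒ `H⁵(𝒫) = W_𝒫 × I`. -/
def DoubleReduction : Prop :=
  ∀ (M : Type) [TopologicalSpace M] [T2Space M] [SecondCountableTopology M]
    [ChartedSpace (EuclideanSpace ℝ (Fin 4)) M] [IsManifold (𝓡 4) ∞ M],
    M ≃ₕ 𝕊⁴ →
    (∃ (W₁ : Type) (_ : TopologicalSpace W₁) (_ : ChartedSpace (EuclideanHalfSpace 4) W₁)
      (_ : IsManifold (𝓡∂ 4) ∞ W₁) (_ : CompactSpace W₁) (W₂ : Type) (_ : TopologicalSpace W₂)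
      (_ : ChartedSpace (EuclideanHalfSpace 4) W₂) (_ : IsManifold (𝓡∂ 4) ∞ W₂) (_ : CompactSpace W₂)
      (J₁ : SteinStructure W₁) (J₂ : SteinStructure W₂) (e₁ : W₁ → M) (e₂ : W₂ → M),
      Manifold.IsSmoothEmbedding (𝓡∂ 4) (𝓡 4) ∞ e₁ ∧ Manifold.IsSmoothEmbedding (𝓡∂ 4) (𝓡 4) ∞ e₂ ∧
      range e₁ ∪ range e₂ = univ ∧ range e₁ ∩ range e₂ = e₁ '' (𝓡∂ 4).boundary W₁ ∧
      range e₁ ∩ range e₂ = e₂ '' (𝓡∂ 4).boundary W₂ ∧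
      (∀ w₁ w₂, e₁ w₁ = e₂ w₂ →
        Submodule.map (mfderiv (𝓡∂ 4) (𝓡 4) e₁ w₁).toLinearMap (contactPlane J₁.J w₁) =
          Submodule.map (mfderiv (𝓡∂ 4) (𝓡 4) e₂ w₂).toLinearMap (contactPlane J₂.J w₂)) ∧
      (∀ k, 0 < k →
        CategoryTheory.Limits.IsZero
            (Literature.AlgebraicTopology.SingularHomology.singularHomology ℚ ℚ W₁ k) ∧
          CategoryTheory.Limits.IsZero
            (Literature.AlgebraicTopology.SingularHomology.singularHomology ℚ ℚ W₂ k))) →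
    ∃ (W : Type) (_ : TopologicalSpace W) (_ : ChartedSpace (EuclideanHalfSpace 4) W)
      (_ : IsManifold (𝓡∂ 4) ∞ W) (_ : CompactSpace W) (_ : ContractibleSpace W)
      (_ : SteinStructure W) (b : BoundaryData (𝓡∂ 4) W (𝓡 3)), IsDouble b (𝓡 4) M

/-- **Composition (kernel-checked shape of the line)**: the transfer target plus crux 4
(route item stmt-SmoothPoincare4-3546) prove the crux BY NAME. -/
theorem crux_of_doubleReduction (hD : DoubleReduction)
    (h4 : ConvexBisection.ContractibleTwistedDoubleStandard) :
    ConvexBisection.AcyclicBisectionRigidity := by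
  intro M _ _ _ _ _ hM hB
  obtain ⟨W, _, _, _, _, _, S, b, hWD⟩ := hD M hM hB
  exact double_standard_of_crux h4 W S b M hWD

end Transfer

/-! ## §4 Exchange recognition (card `exchange-recognition`)

An EXCHANGE PAIR on a link `Λ = A ∪ B ⊂ S³` (both sublinks unlinks, `|A| = |B|`) is
`W_A = {A dotted, B 0-framed}`, `W_B = {A 0-framed, B dotted}`; `W_A ∪_{id} W̄_B ≅ S⁴` by
cross-cancellation (the upside-down 2-handles of `W_B` are 0-framed meridians of the dotted
circles of `W_A`).  In-print NON-TWIN inhabitant of the crux (Hayden arXiv:2003.13681 Thm 1.3,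
`W = Σ₂(B⁴, C)`, `W′ = Σ₂(B⁴, C′)`) is an exchange pair on the lifted 4-component link, hence
`W ∪ W̄′ ≅ S⁴` (and likewise for all cyclic covers `Σ_d`).  The tree has no Kirby-diagram carrier
for dotted circles, so the first lemma is stated as the RECOGNITION form of the crux: it suffices
that the second half be the complement of an embedding of the first half in `S⁴` compatible with
the seam. -/

section Exchange

open Summit.SmoothPoincare4.SmoothPoincare4.Theses

local notation "𝕊⁴" => (Metric.sphere (0 : EuclideanSpace ℝ (Fin 5)) 1)

/-- **ComplementRecognition** (tautological but the shape every exchange argument instantiates):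
if the glued manifold's second piece re-parametrises the closed complement of an embedding of the
first piece in `S⁴`, i.e. if `S⁴` itself is a boundary gluing of `W₁` and `W₂` along the SAME seam
map `φ` as `M`, then `M ≅ S⁴` (uniqueness of boundary gluings,
`nonempty_diffeomorph_of_isBoundaryGluing`, tree). The exchange lemma supplies the hypothesis for
exchange pairs with `φ` = identity of `S³_0(Λ)`. -/
def ComplementRecognition : Prop :=
  ∀ (M : Type) [TopologicalSpace M] [T2Space M] [SecondCountableTopology M]
    [ChartedSpace (EuclideanSpace ℝ (Fin 4)) M] [IsManifold (𝓡 4) ∞ M]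
    (W₁ : Type) [TopologicalSpace W₁] [ChartedSpace (EuclideanHalfSpace 4) W₁]
    [IsManifold (𝓡∂ 4) ∞ W₁] [CompactSpace W₁]
    (W₂ : Type) [TopologicalSpace W₂] [ChartedSpace (EuclideanHalfSpace 4) W₂]
    [IsManifold (𝓡∂ 4) ∞ W₂] [CompactSpace W₂]
    (b₁ : BoundaryData (𝓡∂ 4) W₁ (𝓡 3)) (b₂ : BoundaryData (𝓡∂ 4) W₂ (𝓡 3))
    (φ : b₁.carrier ≃ b₂.carrier),
    IsBoundaryGluing b₁ b₂ φ (𝓡 4) M → IsBoundaryGluing b₁ b₂ φ (𝓡 4) 𝕊⁴ →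
    Nonempty (M ≃ₘ⟮𝓡 4, 𝓡 4⟯ 𝕊⁴)

end Exchange

end Summit.SmoothPoincare4.SmoothPoincare4.Cruxes.AcyclicBisectionRigidity.Ideas
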